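import Literature.NumberTheory.Automorphic.AdelicVectorHeight
import Literature.NumberTheory.Automorphic.GaloisActionAdeleRing
import Mathlib.Algebra.FiniteSupport.Basic
import HarnessLib

/-!
# Galois invariance of the heights of adelic vectors

Topic `NumberTheory/Automorphic`; namespace `Literature.NumberTheory.Automorphic`. Everything
proved, no instances.

For a number field `L`, an automorphism `σ ∈ Aut(L/K)` acts on the adele ring `𝔸_L`
(`GaloisActionAdeleRing.lean`: componentwise transport `L_w → L_{σ w}`), hence coordinatewise on
adelic vectors `x ∈ 𝔸_L^ι`.  The local heights of `AdelicVectorHeight.lean` (`vecFinHeight`,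
`vecArchNorm`, `vecHeight`, `IsHeightFinite`; Godement, Sém. Bourbaki 257 §1.1 [Godement1964]) are
PERMUTED by `σ`
(`‖(σ • a)_{σ w}‖ = ‖a_w‖`: `norm_galAdicCompletionMap` below at the finite places,
`norm_galInfiniteCompletionMap` at the infinite ones), so the global height — a product over all
places — is INVARIANT: `h(σ • x) = h(x)`.

* `norm_galAdicCompletionMap` — `‖σ y‖_{σ w} = ‖y‖_w` (finite places);
* `vecFinHeight_galSmul`, `vecArchNorm_galSmul` — `h_v(σ • x) = h_{σ⁻¹ v}(x)`,
  `‖σ • x‖_w = ‖x‖_{σ⁻¹ w}`;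
* `isHeightFinite_galSmul_iff` — height-finiteness is invariant;
* **`vecHeight_galSmul`** — `h(σ • x) = h(x)`.

## Provenance

Reproduced for the tree under the LEAN-IN-TREE rule (2026-08-18) from the pub-hodgecm cell's
package files `HodgeCM/PerL34/HeightGalois.lean` (105 lines; DAG-node prover #10 lineage, seat
pv10-g3, gate run 27) and — the finite-place isometry `norm_galAdicCompletionMap` with its helper —
`HodgeCM/PerL34/NormOneRelTorus.lean` §1 (seat pv11-g4, gate run 25), verbatim up to the namespace
(`HodgeCM.PerL34.HeightGalois` / `NumberField` ↦ `Literature.NumberTheory.Automorphic`), the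
vendored imports replaced by the tree originals, and added docstring tags.
-/

set_option autoImplicit false

noncomputable section

open scoped NNReal

namespace Literature.NumberTheory.Automorphic

open NumberField IsDedekindDomain

section GaloisNorm

variable {K L : Type} [Field K] [Field L] [NumberField L] [Algebra K L]

/-- Base-congruence for `WithZeroMulInt.toNNReal` (the base is determined by a proof argument).
[folklore] -/
theorem WithZeroMulInt.toNNReal_congr_base {e e' : ℝ≥0} (he : e ≠ 0) (he' : e' ≠ 0) (h : e = e')
    (x : WithZero (Multiplicative ℤ)) :
    WithZeroMulInt.toNNReal he x = WithZeroMulInt.toNNReal he' x := by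
  subst h; rfl

/-- **Local isometry at the finite places**: `‖σ y‖_{σ w} = ‖y‖_w` for the transport
`L_w → L_{σ w}` (the valuation is preserved, `valued_galAdicCompletionMap`, and conjugate primes
have the same residue cardinality, `HeightOneSpectrum.absNorm_algEquiv_smul`). [folklore] -/
theorem norm_galAdicCompletionMap (σ : L ≃ₐ[K] L) {w w' : HeightOneSpectrum (𝓞 L)}
    (h : σ • w = w') (y : w.adicCompletion L) : ‖galAdicCompletionMap σ h y‖ = ‖y‖ := by
  subst h
  rw [FinitePlace.norm_def, FinitePlace.norm_def, valued_galAdicCompletionMap]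
  congr 1
  refine WithZeroMulInt.toNNReal_congr_base _ _ ?_ _
  rw [Literature.NumberTheory.Automorphic.HeightOneSpectrum.absNorm_algEquiv_smul]

end GaloisNorm

section Heights

variable {K L : Type} [Field K] [Field L] [NumberField L] [Algebra K L] {ι : Type*} [Fintype ι]

omit [Fintype ι] in
/-- Coordinates of `σ • x` (definitional). [folklore] -/
theorem galSmul_apply (σ : L ≃ₐ[K] L) (x : ι → AdeleRing (𝓞 L) L) (i : ι) :
    (σ • x) i = σ • x i := rfl

/-- **Finite local heights are permuted**: `h_v(σ • x) = h_{σ⁻¹ v}(x)`. [folklore] -/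
theorem vecFinHeight_galSmul (σ : L ≃ₐ[K] L) (v : HeightOneSpectrum (𝓞 L))
    (x : ι → AdeleRing (𝓞 L) L) :
    vecFinHeight L v (σ • x) = vecFinHeight L (σ⁻¹ • v) x := by
  unfold vecFinHeight
  refine Finset.sup_congr rfl fun i _ => ?_
  apply NNReal.eq
  simp only [coe_nnnorm, galSmul_apply, AdeleRing.smul_snd, FiniteAdeleRing.smul_apply]
  exact norm_galAdicCompletionMap σ _ _

/-- **Archimedean norms are permuted**: `‖σ • x‖_w = ‖x‖_{σ⁻¹ w}`. [folklore] -/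
theorem vecArchNorm_galSmul (σ : L ≃ₐ[K] L) (w : InfinitePlace L) (x : ι → AdeleRing (𝓞 L) L) :
    vecArchNorm L w (σ • x) = vecArchNorm L (σ⁻¹ • w) x := by
  unfold vecArchNorm
  congr 1
  refine Finset.sum_congr rfl fun i _ => ?_
  congr 1
  apply NNReal.eq
  simp only [coe_nnnorm, galSmul_apply, AdeleRing.smul_fst, InfiniteAdeleRing.smul_apply]
  exact norm_galInfiniteCompletionMap K σ _ _

omit [NumberField L] in
/-- The multiplicity `mult w = [L_w : ℝ]` is `Aut(L/K)`-invariant. [folklore] -/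
theorem mult_galSmul (σ : L ≃ₐ[K] L) (w : InfinitePlace L) : (σ • w).mult = w.mult := by
  unfold InfinitePlace.mult
  rw [InfinitePlace.isReal_smul_iff]

/-- Height-finiteness is `Aut(L/K)`-invariant. [folklore] -/
theorem isHeightFinite_galSmul_iff (σ : L ≃ₐ[K] L) (x : ι → AdeleRing (𝓞 L) L) :
    IsHeightFinite L (σ • x) ↔ IsHeightFinite L x := by
  unfold IsHeightFinite
  have h : (fun v => vecFinHeight L v (σ • x)) =
      (fun v => vecFinHeight L v x) ∘ fun v => σ⁻¹ • v := by
    funext v; exact vecFinHeight_galSmul σ v x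
  rw [h]
  constructor
  · intro hf
    have h2 : (fun v => vecFinHeight L v x) =
        ((fun v => vecFinHeight L v x) ∘ fun v => σ⁻¹ • v) ∘ fun v => σ • v := by
      funext v; simp only [Function.comp_apply, inv_smul_smul]
    rw [h2]
    exact hf.comp_of_injective (MulAction.injective σ)
  · intro hf
    exact hf.comp_of_injective (MulAction.injective σ⁻¹)

/-- **Galois invariance of the height**: `h(σ • x) = h(x)` for `σ ∈ Aut(L/K)` and `x ∈ 𝔸_L^ι`.
[cite: Godement1964, §1.1] -/
theorem vecHeight_galSmul (σ : L ≃ₐ[K] L) (x : ι → AdeleRing (𝓞 L) L) :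
    vecHeight L (σ • x) = vecHeight L x := by
  unfold vecHeight
  congr 1
  · -- archimedean part: reindex along `w ↦ σ • w`
    refine (Fintype.prod_equiv (MulAction.toPerm σ) (fun w => vecArchNorm L w x ^ w.mult)
      (fun w => vecArchNorm L w (σ • x) ^ w.mult) fun w => ?_).symm
    rw [MulAction.toPerm_apply, vecArchNorm_galSmul, inv_smul_smul, mult_galSmul]
  · -- finite part: reindex along `v ↦ σ⁻¹ • v`
    simp_rw [vecFinHeight_galSmul σ _ x]
    exact finprod_eq_of_bijective (fun v => σ⁻¹ • v) (MulAction.bijective σ⁻¹) fun _ => rfl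

end Heights

end Literature.NumberTheory.Automorphic

end
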